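import Literature.NumberTheory.EllipticCurves.ClassPolynomialNegForty
import Mathlib.FieldTheory.Minpoly.IsIntegrallyClosed
import Mathlib.Analysis.Complex.ExponentialBounds
import HarnessLib

/-!
# The class polynomial of discriminant `−52`: `H_{−52}(X) = X² − 6896880000·X − 567663552000000`, and the
# singular moduli `j(√−13) = 3448440000 + 956448000√13`, `j((−1+√−13)/2) = 3448440000 − 956448000√13`

certified instances and evidence bearing on the general Hodge conjecture; no claim.

Topic `NumberTheory/EllipticCurves` (singular moduli); theorem-only (no definition, no named fact); vocabulary `classPolynomial`, `formJ`, `heegnerTau`.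

PRINTED (the value). S. Ramanujan, *Modular equations and approximations to π*, Quart. J. Math. 45 (1914) 350–372
(= Collected Papers, CUP 1927, paper 6; held text: galaxy panama 257448929656924, chunk p0048), §6, L41: "`G₁₃⁴ = (3+√13)/2`"
(in the list 'Many of these results are equivalent to results given by Weber'), L45: "In Weber's notation,
`G_n = 2^{−1/4} f{√(−n)}` and `g_n = 2^{−1/4} f₁{√(−n)}`" (§1 eq. (1), chunk p0045 L88:
`(1 + e^{−π√n})(1 + e^{−3π√n})(1 + e^{−5π√n})⋯ = 2^{1/4} e^{−π√n/24} G_n`).  D. A. Cox, *Primes of the form x² + ny²*, 2nd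
ed. (2013), §12.B Thm. 12.17: `γ₂(τ) = (f(τ)²⁴ − 16)/f(τ)⁸ = (f₁(τ)²⁴ + 16)/f₁(τ)⁸`, and the Remark after it:
`j(τ) = γ₂(τ)³`.  CONSEQUENCE (exact arithmetic in `ℚ(√13)`, ours; two implementations in the cell records): with
`u = G₁₃⁴ = (3 + √13)/2`: `f(√−13)⁸ = 4G₁₃⁸ = 4u² = 22 + 6√13`, `f(√−13)²⁴ = 64G₁₃²⁴ = 64u⁶ = 41536 + 11520√13`, hence
`γ₂(√−13) = (f²⁴ − 16)/f⁸ = (41520 + 11520√13)/(22 + 6√13) = 930 + 270√13 = 30(31 + 9√13)` and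
`j(√−13) = γ₂(√−13)³ = 3448440000 + 956448000√13`; with its `ℚ(√13)`-conjugate (the `2`-isogenous class, below):
`H_{−52}(X) = X² − 6896880000X − 567663552000000`.  No Weber function enters the Lean file: the kernel derives the same
integers independently, by the method below.

METHOD (OURS) = anchor `ClassPolynomialNegForty` (steps (1)–(6) there: reduced forms, `2`-isogeny, the symmetric reduction
`G(s,p) = 0` of the tree's explicit `Φ₂` with `ClassPolynomialNegForty.exists_sq_of_G_eq_zero` REUSED, integrality of `s = j₁ + j₂`,
`p = j₁j₂` via `minpoly_formJ_map_eq_classPolynomial`, one numeric pin, root selection), with two variants.  (i) The isogeny is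
`(τ₁ + 1)/2`: `(τ_{(1,0,13)} + 1)/2 = τ_{(4,−4,14)} = τ_{(2,−2,7)} ∼ τ_{(2,2,7)}`, so `j₂ = j(τ_{(2,2,7)})` is the THIRD root of the
fibre `Φ₂(x, j₁) = (x − j(2τ₁))(x − j(τ₁/2))(x − j((τ₁+1)/2))` (the `ClassPolynomialNegOneHundredTwelve` pattern, Cox Thm. 11.2
for `(2,−2,7) ∼ (2,2,7)`).  (ii) The nome at `τ₂ = (−1+i√13)/2` is the NEGATIVE real `−e^{−π√13}` (`|q| ≈ 1.2·10⁻⁵ ≤ 10⁻⁴`; at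
`τ₁ = i√13` it is `e^{−2π√13}`), so with `E = e^{π√13}` the tree's cusp estimate `|j − 1/q − 744| ≤ 4·10⁵|q|` gives
`|s − (E² − E + 1488)| ≤ 4.8166`; the kernel pin `83047.9 ≤ e^{π√13} ≤ 83048` (`Real.pi_gt_d20`/`pi_lt_d20`, `√13` by
squaring, `e^x = (e¹)¹¹·e^{x−11}` with `Real.exp_one_gt_d9`/`lt_d9` and ten Taylor terms — no floating point) gives
`166093² < m² < 166097²`, so `|m| = 166095`, `s = 6896880000`; here `p < 0`: the UPPER bound
`|p| = |j₁||j₂| ≤ (E² + 744.0001)(E − 739.1835) ≤ 5.7·10¹⁴` excludes `m = +166095` (`p = 577905459897375`), so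
`p = −567663552000000`; `(2j₁ − s)² = s² − 4p = 13·1912896000²` and `|j₁| > 10⁵` select `j₁ = 3448440000 + 956448000√13`.

LIMITS. Kernel theorem whose VALUE is the one fixed in print by the Weber–Ramanujan class invariant `G₁₃` [Ramanujan1914] through
[Cox2013, Thm. 12.17]; method, windows, pin, constants ours; theorem-only; extends the tree's kernel `h = 2` table beyond the [Ishii2004]
rows; no census number changes; nothing about HC.  References: [Ramanujan1914] §§1, 6; [Cox2013] Thm. 2.13, §11.A Thm. 11.2, §11.B
(11.14)–(11.15), Thm. 11.1, Thm. 11.18, §12.B Thm. 12.17, §13.A Prop. 13.2; [GranvilleStark2000] §2 (`|1/q| = e^{π√d/a}`).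
-/

noncomputable section

open Complex Polynomial
open UpperHalfPlane hiding I
open scoped Real

namespace Literature.NumberTheory.EllipticCurves

open ModularForms ModularPolynomialTwo
open Literature.NumberTheory.QuadraticFields.BinaryQuadraticForm (reducedForms)
open Literature.NumberTheory.QuadraticFields.Quadratic (BinQF)

namespace ClassPolynomialNegFiftyTwo
/-- **The pin on integers**: `m² = 4S + 29025`, `6896872129 ≤ S ≤ 6896888749` force `S = 6896880000` (`166093² < m² < 166097²`);
then `m = ±166095` and `|P| ≤ 5.7·10¹⁴` force `m = −166095`, `P = −567663552000000` (`+` would give `577905459897375`). [folklore] -/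
private theorem eq_of_window {S P m : ℤ} (hm : m ^ 2 = 4 * S + 29025)
    (hPm : 2 * P - 1485 * S - 41097375 = (S + 191025) * m)
    (hlo : 6896872129 ≤ S) (hhi : S ≤ 6896888749) (hP : |P| ≤ 57 * 10 ^ 13) :
    S = 6896880000 ∧ P = -567663552000000 := by
  have h1 : |(166093 : ℤ)| < |m| := sq_lt_sq.mp (by nlinarith)
  have h2 : |m| < |(166097 : ℤ)| := sq_lt_sq.mp (by nlinarith)
  rw [abs_of_pos (by norm_num : (0 : ℤ) < 166093)] at h1; rw [abs_of_pos (by norm_num : (0 : ℤ) < 166097)] at h2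
  obtain ⟨k, hk⟩ : ∃ k : ℤ, |m| = k := ⟨_, rfl⟩
  have hk2 : k ^ 2 = 4 * S + 29025 := by rw [← hk, sq_abs, hm]
  rw [hk] at h1 h2
  have hS : S = 6896880000 := by interval_cases k <;> omega
  refine ⟨hS, ?_⟩
  subst hS
  have hk5 : k = 166095 := by nlinarith
  rcases (abs_eq (by norm_num : (0 : ℤ) ≤ 166095)).mp (hk.trans hk5) with h | h
  · subst h
    have hP' : P = 577905459897375 := by omega
    rw [hP'] at hP
    norm_num at hP
  · subst h; omega

/-- **`(τ₁ + 1)/2 ↔ τ₂`**: `j((τ_{(1,0,13)} + 1)/2) = j(τ_{(4,−4,14)}) = j(τ_{(2,−2,7)}) = j(τ_{(2,2,7)})` — the two classes of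
discriminant `−52` are `2`-isogenous (the prime above the ramified `2` is the non-principal class).
[cite: Cox2013, §11.B (11.14)–(11.15) and §11.A Thm. 11.2] -/
theorem kleinJ_divPoint_two_one : kleinJ (divPoint 2 1 (heegnerTau (1, 0, 13))) = formJ (2, 2, 7) := by
  have h := divPoint_two_heegnerTau (a := 1) (b := 0) (c := 13) one_pos (by norm_num) 1
  norm_num at h
  have h2 : heegnerTau ((4 : ℤ), (-4 : ℤ), (14 : ℤ)) = heegnerTau (2, -2, 7) := by
    apply UpperHalfPlane.ext
    rw [coe_heegnerTau_eq (Q := ((4 : ℤ), (-4 : ℤ), (14 : ℤ))) (D := 4 * (-52)) (by norm_num) (by norm_num) (by norm_num),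
      coe_heegnerTau_eq (Q := ((2 : ℤ), (-2 : ℤ), (7 : ℤ))) (D := -52) (by norm_num) (by norm_num) (by norm_num), sqrtDisc_four_mul]
    push_cast
    ring
  have h3 : formJ (2, -2, 7) = formJ (2, 2, 7) := by
    simpa [BinQF.act] using
      formJ_eq_formJ_act ⟨2, -2, 7⟩ (by norm_num) (by norm_num [BinQF.disc]) (p := 1) (q := 1) (r := 0) (s := 1) (by norm_num)
  rw [h, h2, ← formJ_eq_kleinJ, h3]

/-- **`Φ₂(j₂, j₁) = 0` in symmetric form: `G(j₁ + j₂, j₁j₂) = 0`** for `j₁ = j(τ_{(1,0,13)})`, `j₂ = j(τ_{(2,2,7)})`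
(`j₂ = j((τ₁+1)/2)` is a root of the fibre of `Φ₂` over `j₁`; `Φ₂(x, y) = G(x + y, xy)` by `ring`). [cite: Cox2013, §11.B (11.14)–(11.15)] -/
theorem G_formJ_eq_zero :
    -(formJ (1, 0, 13) * formJ (2, 2, 7)) ^ 2 +
        (1485 * (formJ (1, 0, 13) + formJ (2, 2, 7)) + 41097375) * (formJ (1, 0, 13) * formJ (2, 2, 7)) +
        (formJ (1, 0, 13) + formJ (2, 2, 7)) ^ 3 - 162000 * (formJ (1, 0, 13) + formJ (2, 2, 7)) ^ 2 +
        8748000000 * (formJ (1, 0, 13) + formJ (2, 2, 7)) - 157464000000000 = 0 := by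
  have h := eval_kleinJ_eq_prod (formJ (2, 2, 7)) (heegnerTau (1, 0, 13))
  rw [intModularPolynomial_two_eval, kleinJ_divPoint_two_one, ← formJ_eq_kleinJ (1, 0, 13), sub_self, mul_zero] at h
  linear_combination h

/-- `√(−(−52)) = 2√13` in `ℝ`. [folklore] -/
private theorem sqrt_fiftyTwo : Real.sqrt (-((-52 : ℤ) : ℝ)) = 2 * √(13 : ℝ) := by
  rw [show (-((-52 : ℤ) : ℝ)) = 2 ^ 2 * 13 by norm_num, Real.sqrt_mul (by norm_num), Real.sqrt_sq (by norm_num)]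

/-- **The nome at `τ₂ = τ_{(2,2,7)} = (−1 + i√13)/2` is the NEGATIVE real `−e^{−π√13}`.**
[cite: GranvilleStark2000, §2 proof of Theorem 1 (`|1/q| = e^{π√d/a}`, here `a = 2`)] -/
theorem qParam_heegnerTau_two_two_seven :
    Function.Periodic.qParam 1 (heegnerTau (2, 2, 7) : ℂ) = -(Real.exp (-(π * √(13 : ℝ))) : ℂ) := by
  rw [qParam_one_eq_cexp, coe_heegnerTau_eq (Q := ((2 : ℤ), (2 : ℤ), (7 : ℤ))) (D := -52) (by norm_num) (by norm_num) (by norm_num),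
    sqrtDisc, sqrt_fiftyTwo]
  have harg : 2 * (π : ℂ) * Complex.I * ((Complex.I * ((2 * √(13 : ℝ) : ℝ) : ℂ) - ((2 : ℤ) : ℂ)) / (2 * ((2 : ℤ) : ℂ))) =
      ((-(π * √(13 : ℝ))) : ℝ) - π * Complex.I := by
    push_cast
    linear_combination ((π : ℂ) * (√(13 : ℝ) : ℂ)) * Complex.I_mul_I
  rw [harg, Complex.exp_sub, Complex.exp_pi_mul_I, ← Complex.ofReal_exp, div_neg, div_one]

/-- **The nome at `τ₁ = τ_{(1,0,13)} = i√13` is the positive real `e^{−2π√13} = (e^{−π√13})²`.**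
[cite: GranvilleStark2000, §2 proof of Theorem 1 (`|1/q| = e^{π√d}`)] -/
theorem qParam_heegnerTau_one_zero_thirteen :
    Function.Periodic.qParam 1 (heegnerTau (1, 0, 13) : ℂ) = (Real.exp (-(π * √(13 : ℝ))) ^ 2 : ℂ) := by
  rw [qParam_one_eq_cexp, ← Complex.ofReal_pow, ← Real.exp_nat_mul, Complex.ofReal_exp,
    coe_heegnerTau_eq (Q := ((1 : ℤ), (0 : ℤ), (13 : ℤ))) (D := -52) (by norm_num) (by norm_num) (by norm_num),
    sqrtDisc, sqrt_fiftyTwo]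
  congr 1
  push_cast
  linear_combination (2 * π * (√(13 : ℝ) : ℂ)) * Complex.I_mul_I

/-- **The numeric pin: `83047.9 ≤ e^{π√13} ≤ 83048`** (true value `83047.94737…`) — a kernel inequality from Mathlib's
certified bounds only: `Real.pi_gt_d20`/`pi_lt_d20` and `3.605551275463 < √13 < 3.605551275464` give
`11.327173399 ≤ π√13 ≤ 11.3271734`; `e^x = (e¹)¹¹·e^{x − 11}` with `Real.exp_one_gt_d9`/`lt_d9` and ten Taylor terms
(`Real.exp_bound`). [folklore] -/
private theorem exp_pi_sqrt_thirteen_bounds :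
    (83047.9 : ℝ) ≤ Real.exp (π * √(13 : ℝ)) ∧ Real.exp (π * √(13 : ℝ)) ≤ 83048 := by
  have hs1 : (3.605551275463 : ℝ) < √(13 : ℝ) := (Real.lt_sqrt (by norm_num)).mpr (by norm_num)
  have hs2 : √(13 : ℝ) < 3.605551275464 := (Real.sqrt_lt' (by norm_num)).mpr (by norm_num)
  have hπ1 : (3.14159265358979323846 : ℝ) < π := Real.pi_gt_d20
  have hπ2 : π < 3.14159265358979323847 := Real.pi_lt_d20
  have hx1 : (11.327173399 : ℝ) ≤ π * √(13 : ℝ) := by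
    nlinarith [mul_nonneg (sub_nonneg.mpr hπ1.le) (sub_nonneg.mpr hs1.le)]
  have hx2 : π * √(13 : ℝ) ≤ 11.3271734 := by
    nlinarith [mul_nonneg (sub_nonneg.mpr hπ2.le) (sub_nonneg.mpr hs2.le)]
  have he1 : (2.7182818283 : ℝ) < Real.exp 1 := Real.exp_one_gt_d9
  have he2 : Real.exp 1 < (2.7182818286 : ℝ) := Real.exp_one_lt_d9
  have h11pos := pow_pos (Real.exp_pos (1 : ℝ)) 11
  constructor
  · refine le_trans ?_ (Real.exp_le_exp.mpr hx1)
    have hsplit : Real.exp (11.327173399 : ℝ) = Real.exp 1 ^ 11 * Real.exp (0.327173399 : ℝ) := by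
      rw [← Real.exp_nat_mul, ← Real.exp_add]; norm_num
    have hy : |(0.327173399 : ℝ)| ≤ 1 := by rw [abs_of_pos (by norm_num)]; norm_num
    have hT := Real.exp_bound hy (n := 10) (by norm_num)
    simp only [Finset.sum_range_succ, Finset.sum_range_zero, Nat.factorial, Nat.succ_eq_add_one] at hT
    norm_num at hT
    have hlow := (abs_sub_le_iff.1 hT).2
    have h11 : (2.7182818283 : ℝ) ^ 11 ≤ Real.exp 1 ^ 11 := pow_le_pow_left₀ (by norm_num) he1.le 11
    rw [hsplit]
    nlinarith [Real.exp_pos (0.327173399 : ℝ)]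
  · refine le_trans (Real.exp_le_exp.mpr hx2) ?_
    have hsplit : Real.exp (11.3271734 : ℝ) = Real.exp 1 ^ 11 * Real.exp (0.3271734 : ℝ) := by
      rw [← Real.exp_nat_mul, ← Real.exp_add]; norm_num
    have hy : |(0.3271734 : ℝ)| ≤ 1 := by rw [abs_of_pos (by norm_num)]; norm_num
    have hT := Real.exp_bound hy (n := 10) (by norm_num)
    simp only [Finset.sum_range_succ, Finset.sum_range_zero, Nat.factorial, Nat.succ_eq_add_one] at hT
    norm_num at hT
    have hup := (abs_sub_le_iff.1 hT).1
    have h11 : Real.exp 1 ^ 11 ≤ (2.7182818286 : ℝ) ^ 11 := pow_le_pow_left₀ (Real.exp_pos _).le he2.le 11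
    rw [hsplit]
    nlinarith [Real.exp_pos (0.3271734 : ℝ)]

/-- **`|j(τ_{(2,2,7)}) + e^{π√13} − 744| ≤ 4·10⁵·e^{−π√13}`**: the tree's first-order cusp estimate at `τ₂ = (−1+i√13)/2`
(`q = −e^{−π√13}`, `|q| ≈ 1.2·10⁻⁵ ≤ 10⁻⁴`). [cite: GranvilleStark2000, §2 proof of Theorem 1] -/
theorem norm_formJ_two_two_seven_add_le :
    ‖formJ (2, 2, 7) + (Real.exp (π * √(13 : ℝ)) : ℂ) - 744‖ ≤ 400000 * Real.exp (-(π * √(13 : ℝ))) := by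
  have hq := qParam_heegnerTau_two_two_seven
  have hqn : ‖Function.Periodic.qParam 1 (heegnerTau (2, 2, 7) : ℂ)‖ = Real.exp (-(π * √(13 : ℝ))) := by
    rw [hq, norm_neg, Complex.norm_real, Real.norm_eq_abs, abs_of_pos (Real.exp_pos _)]
  have hq4 : ‖Function.Periodic.qParam 1 (heegnerTau (2, 2, 7) : ℂ)‖ ≤ 1 / 10 ^ 4 := by
    rw [hqn, Real.exp_neg, inv_le_comm₀ (Real.exp_pos _) (by norm_num)]
    have : (1 / (10 : ℝ) ^ 4)⁻¹ = 10 ^ 4 := by norm_num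
    rw [this]; linarith [exp_pi_sqrt_thirteen_bounds.1]
  have hj : formJ (2, 2, 7) = ModularForm.E₄ (heegnerTau (2, 2, 7)) ^ 3 / ModularForm.discriminant (heegnerTau (2, 2, 7)) := by
    rw [formJ_eq_kleinJ]; rfl
  have hcusp := norm_E₄_cube_div_discriminant_sub_sub_le (heegnerTau (2, 2, 7)) hq4
  rw [← hj, hqn, hq, inv_neg, ← Complex.ofReal_inv, Real.exp_neg, inv_inv, sub_neg_eq_add] at hcusp
  rw [Real.exp_neg]; exact hcusp

/-- **`|j(i√13) − e^{2π√13} − 744| ≤ 4·10⁵·e^{−2π√13}`**: the cusp estimate at `τ₁ = i√13` (`q = e^{−2π√13}`).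
[cite: GranvilleStark2000, §2 proof of Theorem 1] -/
theorem norm_formJ_one_zero_thirteen_sub_le :
    ‖formJ (1, 0, 13) - (Real.exp (π * √(13 : ℝ)) : ℂ) ^ 2 - 744‖ ≤ 400000 * Real.exp (-(π * √(13 : ℝ))) ^ 2 := by
  have hq := qParam_heegnerTau_one_zero_thirteen
  have hqn : ‖Function.Periodic.qParam 1 (heegnerTau (1, 0, 13) : ℂ)‖ = Real.exp (-(π * √(13 : ℝ))) ^ 2 := by
    rw [hq, ← Complex.ofReal_pow, Complex.norm_real, Real.norm_eq_abs, abs_of_pos (pow_pos (Real.exp_pos _) 2)]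
  have hE := exp_pi_sqrt_thirteen_bounds.1
  have hq4 : ‖Function.Periodic.qParam 1 (heegnerTau (1, 0, 13) : ℂ)‖ ≤ 1 / 10 ^ 4 := by
    rw [hqn, Real.exp_neg, inv_pow, inv_le_comm₀ (pow_pos (Real.exp_pos _) 2) (by norm_num)]
    have : (1 / (10 : ℝ) ^ 4)⁻¹ = 10 ^ 4 := by norm_num
    rw [this]; nlinarith [Real.exp_pos (π * √(13 : ℝ))]
  have hj : formJ (1, 0, 13) = ModularForm.E₄ (heegnerTau (1, 0, 13)) ^ 3 / ModularForm.discriminant (heegnerTau (1, 0, 13)) := by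
    rw [formJ_eq_kleinJ]; rfl
  have hcusp := norm_E₄_cube_div_discriminant_sub_sub_le (heegnerTau (1, 0, 13)) hq4
  rw [← hj, hqn, hq, ← Complex.ofReal_pow, ← Complex.ofReal_inv, ← inv_pow, Real.exp_neg, inv_inv,
    Complex.ofReal_pow] at hcusp
  rw [Real.exp_neg]; exact hcusp

/-- **`e^{2π√13} + 743.9999 ≤ |j(i√13)| ≤ e^{2π√13} + 744.0001`** (the window at `τ₁`, `E ≥ 83047.9`). [cite: GranvilleStark2000, §2 proof of Theorem 1] -/
theorem norm_formJ_one_zero_thirteen_bounds : Real.exp (π * √(13 : ℝ)) ^ 2 + 743.9999 ≤ ‖formJ (1, 0, 13)‖ ∧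
    ‖formJ (1, 0, 13)‖ ≤ Real.exp (π * √(13 : ℝ)) ^ 2 + 744.0001 := by
  have hw := norm_formJ_one_zero_thirteen_sub_le
  obtain ⟨hE1, -⟩ := exp_pi_sqrt_thirteen_bounds
  rw [Real.exp_neg] at hw
  set E := Real.exp (π * √(13 : ℝ))
  have hb : 400000 * E⁻¹ ^ 2 ≤ 1 / 10 ^ 4 := by
    rw [inv_pow, ← div_eq_mul_inv, div_le_iff₀ (by positivity)]; nlinarith
  have e : formJ (1, 0, 13) = ((E : ℂ) ^ 2 + 744) + (formJ (1, 0, 13) - (E : ℂ) ^ 2 - 744) := by ring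
  have e' : (E : ℂ) ^ 2 + 744 = formJ (1, 0, 13) - (formJ (1, 0, 13) - (E : ℂ) ^ 2 - 744) := by ring
  have htri := norm_add_le ((E : ℂ) ^ 2 + 744) (formJ (1, 0, 13) - (E : ℂ) ^ 2 - 744)
  have htri' := norm_sub_le (formJ (1, 0, 13)) (formJ (1, 0, 13) - (E : ℂ) ^ 2 - 744)
  rw [← e] at htri; rw [← e'] at htri'
  have hval : ‖(E : ℂ) ^ 2 + 744‖ = E ^ 2 + 744 := by
    rw [show (E : ℂ) ^ 2 + 744 = ((E ^ 2 + 744 : ℝ) : ℂ) by push_cast; ring, Complex.norm_real, Real.norm_eq_abs, abs_of_pos (by positivity)]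
  constructor <;> linarith

/-- **`|j(τ_{(2,2,7)})| ≤ e^{π√13} − 739.1835`** (upper side of the window at `τ₂`). [cite: GranvilleStark2000, §2 proof of Theorem 1] -/
theorem norm_formJ_two_two_seven_le : ‖formJ (2, 2, 7)‖ ≤ Real.exp (π * √(13 : ℝ)) - 739.1835 := by
  have hw := norm_formJ_two_two_seven_add_le
  obtain ⟨hE1, -⟩ := exp_pi_sqrt_thirteen_bounds
  rw [Real.exp_neg] at hw
  set E := Real.exp (π * √(13 : ℝ))
  have hb : 400000 * E⁻¹ ≤ 4.8165 := by rw [← div_eq_mul_inv, div_le_iff₀ (Real.exp_pos _)]; nlinarith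
  have htri : ‖formJ (2, 2, 7)‖ ≤ ‖-(E : ℂ) + 744‖ + ‖formJ (2, 2, 7) + (E : ℂ) - 744‖ := by
    have e : formJ (2, 2, 7) = (-(E : ℂ) + 744) + (formJ (2, 2, 7) + (E : ℂ) - 744) := by ring
    conv_lhs => rw [e]
    exact norm_add_le _ _
  have hval : ‖-(E : ℂ) + 744‖ = E - 744 := by
    rw [show -(E : ℂ) + 744 = ((-E + 744 : ℝ) : ℂ) by push_cast; ring, Complex.norm_real, Real.norm_eq_abs, abs_of_neg (by linarith)]
    ring
  linarith

/-- `reducedForms (−52) = {(1,0,13), (2,2,7)}` (`h(−52) = 2`). [cite: Cox2013, Thm. 2.13] -/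
theorem reducedForms_neg_52 : reducedForms (-52) = {((1 : ℤ), (0 : ℤ), (13 : ℤ)), (2, 2, 7)} := by
  decide +kernel

/-- **`H_{−52}` is the image in `ℂ[X]` of `minpoly_ℤ(j(i√13))`** (the class polynomial has integer coefficients:
Cox Prop. 13.2 with Thm. 11.1 (i), and `ℤ` integrally closed). [cite: Cox2013, §13.A Prop. 13.2 (with Thm. 11.1 (i))] -/
theorem classPolynomial_neg_52_eq_map_minpoly_int :
    classPolynomial (-52) = (minpoly ℤ (formJ (1, 0, 13))).map (algebraMap ℤ ℂ) := by
  have hD : (-52 : ℤ) < 0 := by norm_num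
  have hint : IsIntegral ℤ (formJ (1, 0, 13)) :=
    isIntegral_int_formJ (Q := ((1 : ℤ), (0 : ℤ), (13 : ℤ))) (by decide) (by decide) (by decide)
  have hmin := minpoly_formJ_map_eq_classPolynomial (D := -52) (Q := ((1 : ℤ), (0 : ℤ), (13 : ℤ))) hD
    (by rw [reducedForms_neg_52]; simp)
  rw [← hmin, minpoly.isIntegrallyClosed_eq_field_fractions' ℚ hint, Polynomial.map_map]
  congr 1

/-- **`j₁ + j₂ ∈ ℤ` and `j₁j₂ ∈ ℤ`**: the coefficients of `H_{−52} = (X − j₁)(X − j₂) ∈ ℤ[X]`. [cite: Cox2013, §13.A Prop. 13.2 (with Thm. 11.1 (i))] -/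
theorem exists_int_trace_norm :
    ∃ S P : ℤ, formJ (1, 0, 13) + formJ (2, 2, 7) = S ∧ formJ (1, 0, 13) * formJ (2, 2, 7) = P := by
  set M := minpoly ℤ (formJ (1, 0, 13)) with hM
  have h := classPolynomial_neg_52_eq_map_minpoly_int
  rw [classPolynomial, reducedForms_neg_52, Finset.prod_pair (by decide)] at h
  have hprod : (X - C (formJ (1, 0, 13))) * (X - C (formJ (2, 2, 7))) =
      X ^ 2 - C (formJ (1, 0, 13) + formJ (2, 2, 7)) * X + C (formJ (1, 0, 13) * formJ (2, 2, 7)) := by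
    rw [C_add, C_mul]; ring
  rw [hprod] at h
  have h1 := congr_arg (fun p : ℂ[X] => p.coeff 1) h
  have h0 := congr_arg (fun p : ℂ[X] => p.coeff 0) h
  simp only [coeff_add, coeff_sub, coeff_X_pow, coeff_C_mul, coeff_X, coeff_C, coeff_map, eq_intCast] at h1 h0
  norm_num at h1 h0
  refine ⟨-(M.coeff 1), M.coeff 0, ?_, ?_⟩
  · push_cast; linear_combination -h1
  · exact_mod_cast h0

/-- **Trace and norm: `j₁ + j₂ = 6896880000`, `j₁j₂ = −567663552000000`** — the coefficients of
`H_{−52}(X) = X² − 6896880000X − 567663552000000`, derived in the kernel by steps (2)–(5) of the module docstring; the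
value is the one fixed in print by `G₁₃⁴ = (3 + √13)/2` through `γ₂ = (f²⁴ − 16)/f⁸`, `j = γ₂³`.
[cite: Ramanujan1914, §6 (`G₁₃⁴ = (3+√13)/2`, `G_n = 2^{−1/4} f(√−n)`)] [cite: Cox2013, §12.B Thm. 12.17] -/
theorem formJ_add_and_mul :
    formJ (1, 0, 13) + formJ (2, 2, 7) = 6896880000 ∧ formJ (1, 0, 13) * formJ (2, 2, 7) = -567663552000000 := by
  obtain ⟨S, P, hS, hP⟩ := exists_int_trace_norm
  have hw1 := norm_formJ_one_zero_thirteen_sub_le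
  have hw2 := norm_formJ_two_two_seven_add_le
  have hu1 := norm_formJ_one_zero_thirteen_bounds.2
  have hu2 := norm_formJ_two_two_seven_le
  obtain ⟨hE1, hE2⟩ := exp_pi_sqrt_thirteen_bounds
  rw [Real.exp_neg] at hw1 hw2
  set E := Real.exp (π * √(13 : ℝ)) with hEdef
  have hEpos : 0 < E := Real.exp_pos _
  have hb1 : 400000 * E⁻¹ ^ 2 ≤ 1 / 10 ^ 4 := by
    rw [inv_pow, ← div_eq_mul_inv, div_le_iff₀ (by positivity)]; nlinarith
  have hb2 : 400000 * E⁻¹ ≤ 4.8165 := by rw [← div_eq_mul_inv, div_le_iff₀ hEpos]; nlinarith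
  have htr : ‖((S : ℂ)) - ((E ^ 2 - E + 1488 : ℝ) : ℂ)‖ ≤ 4.8166 := by
    have e : (S : ℂ) - ((E ^ 2 - E + 1488 : ℝ) : ℂ) =
        (formJ (1, 0, 13) - (E : ℂ) ^ 2 - 744) + (formJ (2, 2, 7) + (E : ℂ) - 744) := by
      rw [← hS]; push_cast; ring
    rw [e]
    exact (norm_add_le _ _).trans (by linarith)
  have e : ((S : ℂ)) - ((E ^ 2 - E + 1488 : ℝ) : ℂ) = (((S : ℝ) - (E ^ 2 - E + 1488) : ℝ) : ℂ) := by
    push_cast; ring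
  rw [e, Complex.norm_real, Real.norm_eq_abs] at htr
  obtain ⟨hlo', hhi'⟩ := abs_le.mp htr
  have hlo : (6896872129 : ℤ) ≤ S := by exact_mod_cast (by nlinarith : (6896872129 : ℝ) ≤ S)
  have hhi : S ≤ (6896888749 : ℤ) := by exact_mod_cast (by nlinarith : (S : ℝ) ≤ 6896888749)
  have hPabs : |P| ≤ (57 * 10 ^ 13 : ℤ) := by
    have h : ‖(P : ℂ)‖ ≤ (57 * 10 ^ 13 : ℝ) := by
      rw [← hP, norm_mul]
      calc ‖formJ (1, 0, 13)‖ * ‖formJ (2, 2, 7)‖ ≤ (E ^ 2 + 744.0001) * (E - 739.1835) :=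
            mul_le_mul hu1 hu2 (norm_nonneg _) (by positivity)
        _ ≤ (57 * 10 ^ 13 : ℝ) := by nlinarith
    rw [Complex.norm_intCast] at h
    exact_mod_cast h
  have hG : -P ^ 2 + (1485 * S + 41097375) * P + S ^ 3 - 162000 * S ^ 2 + 8748000000 * S - 157464000000000 = 0 := by
    have h := G_formJ_eq_zero
    rw [hS, hP] at h
    exact_mod_cast h
  obtain ⟨m, hm, hPm⟩ := ClassPolynomialNegForty.exists_sq_of_G_eq_zero hG (by omega)
  obtain ⟨rfl, rfl⟩ := eq_of_window hm hPm hlo hhi hPabs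
  exact ⟨by exact_mod_cast hS, by exact_mod_cast hP⟩

/-- `(√13)² = 13` in `ℂ`. [folklore] -/
private theorem sqrt_thirteen_sq : ((√(13 : ℝ) : ℝ) : ℂ) ^ 2 = 13 := by
  rw [← Complex.ofReal_pow, Real.sq_sqrt (by norm_num)]; norm_num

/-- **`j(i√13) = 3448440000 + 956448000√13 = (30(31 + 9√13))³ = γ₂(√−13)³`**: the root of `H_{−52}` of modulus `> 10⁵`;
the conjugate root is `≈ −82306`. [cite: Ramanujan1914, §6 (`G₁₃⁴ = (3+√13)/2`)] [cite: Cox2013, §12.B Thm. 12.17 (`γ₂ = (f²⁴ − 16)/f⁸`, `j = γ₂³`)] -/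
theorem formJ_one_zero_thirteen_eq : formJ (1, 0, 13) = 3448440000 + 956448000 * (√(13 : ℝ) : ℂ) := by
  obtain ⟨hs, hp⟩ := formJ_add_and_mul
  have hsq : (2 * formJ (1, 0, 13) - 6896880000) ^ 2 = (1912896000 * (√(13 : ℝ) : ℂ)) ^ 2 := by
    have hj2 : formJ (2, 2, 7) = 6896880000 - formJ (1, 0, 13) := by linear_combination hs
    rw [hj2] at hp
    linear_combination (-4 : ℂ) * hp - 1912896000 ^ 2 * sqrt_thirteen_sq
  rcases sq_eq_sq_iff_eq_or_eq_neg.mp hsq with h | h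
  · linear_combination (1 / 2 : ℂ) * h
  · exfalso
    have hj : formJ (1, 0, 13) = ((3448440000 - 956448000 * √(13 : ℝ) : ℝ) : ℂ) := by
      push_cast; linear_combination (1 / 2 : ℂ) * h
    have hn : (10 ^ 5 : ℝ) ≤ ‖formJ (1, 0, 13)‖ := by
      have h1 := norm_formJ_one_zero_thirteen_bounds.1
      nlinarith [exp_pi_sqrt_thirteen_bounds.1, Real.exp_pos (π * √(13 : ℝ))]
    rw [hj, Complex.norm_real, Real.norm_eq_abs] at hn
    have hs1 : (3.6055512 : ℝ) < √(13 : ℝ) := (Real.lt_sqrt (by norm_num)).mpr (by norm_num)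
    have hs2 : √(13 : ℝ) < 3.6055513 := (Real.sqrt_lt' (by norm_num)).mpr (by norm_num)
    have hlt : |(3448440000 - 956448000 * √(13 : ℝ) : ℝ)| < 10 ^ 5 := by rw [abs_lt]; constructor <;> linarith
    linarith

/-- **`j((−1+i√13)/2) = j(τ_{(2,2,7)}) = 3448440000 − 956448000√13`** (the conjugate root, `2`-isogenous class). [cite: Ramanujan1914, §6] [cite: Cox2013, §12.B Thm. 12.17] -/
theorem formJ_two_two_seven_eq : formJ (2, 2, 7) = 3448440000 - 956448000 * (√(13 : ℝ) : ℂ) := by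
  linear_combination formJ_add_and_mul.1 - formJ_one_zero_thirteen_eq

end ClassPolynomialNegFiftyTwo

open ClassPolynomialNegFiftyTwo

/-- **`H_{−52}(X) = X² − 6896880000·X − 567663552000000`**: the class polynomial of discriminant `−52` (`h(−52) = 2`,
reduced forms `(1,0,13)`, `(2,2,7)`), as a kernel theorem about the tree's
`classPolynomial (−52) = (X − j(τ_{(1,0,13)}))(X − j(τ_{(2,2,7)}))`; the value is the one fixed in print by the class
invariant `G₁₃⁴ = (3 + √13)/2` (`γ₂(√−13) = 30(31 + 9√13)`, `j = γ₂³`).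
[cite: Ramanujan1914, §6 (`G₁₃⁴ = (3+√13)/2`, `G_n = 2^{−1/4} f(√−n)`)] [cite: Cox2013, §12.B Thm. 12.17] -/
theorem classPolynomial_neg_52 : classPolynomial (-52) = X ^ 2 - C (6896880000 : ℂ) * X - C (567663552000000 : ℂ) := by
  rw [classPolynomial, reducedForms_neg_52, Finset.prod_pair (by decide)]
  obtain ⟨hs, hp⟩ := formJ_add_and_mul
  calc (X - C (formJ (1, 0, 13))) * (X - C (formJ (2, 2, 7)))
      = X ^ 2 - C (formJ (1, 0, 13) + formJ (2, 2, 7)) * X + C (formJ (1, 0, 13) * formJ (2, 2, 7)) := by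
        rw [C_add, C_mul]; ring
    _ = X ^ 2 - C (6896880000 : ℂ) * X - C (567663552000000 : ℂ) := by rw [hs, hp, show ((-567663552000000 : ℂ)) = -(567663552000000 : ℂ) by norm_num, C_neg]; ring

/-- `H_{−52}(x) = x² − 6896880000x − 567663552000000` for every `x ∈ ℂ`. [cite: Ramanujan1914, §6] [cite: Cox2013, §12.B Thm. 12.17] -/
theorem classPolynomial_neg_52_eval (x : ℂ) :
    (classPolynomial (-52)).eval x = x ^ 2 - 6896880000 * x - 567663552000000 := by
  rw [classPolynomial_neg_52]
  simp only [eval_sub, eval_mul, eval_pow, eval_X, eval_C]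

/-- **`H_{−52}(0) = −567663552000000 = −82800³`** (the norm of `j(i√13) = γ₂(√−13)³` is a cube; `82800 = 2⁴·3²·5²·23`).
[cite: Ramanujan1914, §6] [cite: Cox2013, §12.B Thm. 12.17] -/
theorem classPolynomial_neg_52_eval_zero : (classPolynomial (-52)).eval 0 = -(82800 ^ 3) := by
  rw [classPolynomial_neg_52_eval]; norm_num

/-- **`H_{−52}(1728) = −579581357654016 = −24074496²`** (minus the norm of `j(i√13) − 1728` is a square; `24074496 = 2⁸·3⁷·43`).
[cite: Ramanujan1914, §6] [cite: Cox2013, §12.B Thm. 12.17] -/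
theorem classPolynomial_neg_52_eval_1728 : (classPolynomial (-52)).eval 1728 = -(24074496 ^ 2) := by
  rw [classPolynomial_neg_52_eval]; norm_num

/-- **`j(𝒪_K) = 3448440000 + 956448000√13` for `K = ℚ(√−13)`**: the `j`-invariant of `𝒪_K = ℤ[√−13]` (the tree's
`cmPeriodPair (−52)`), via `formJ_principalForm`. [cite: Ramanujan1914, §6 (`G₁₃`)] [cite: Cox2013, §12.B Thm. 12.17] -/
theorem j_cmPeriodPair_neg_52 : (cmPeriodPair (-52)).j = 3448440000 + 956448000 * (√(13 : ℝ) : ℂ) := by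
  have hP : Literature.NumberTheory.QuadraticFields.BinaryQuadraticForm.principalForm (-52) =
      ((1 : ℤ), (0 : ℤ), (13 : ℤ)) := by decide
  rw [← formJ_principalForm (D := -52) (by norm_num) (by norm_num), hP, formJ_one_zero_thirteen_eq]

end Literature.NumberTheory.EllipticCurves

end
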